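import Summits.Ventures.Crystal3D.Theorems.StickyWulffConstantNoReconstructionGainSampleDeficit
import HarnessLib

/-!
# Unimodular frames for the three in-plane bond classes (riser ledger, charts)

HONEST FRAMING. Part of the venture `Summits/Ventures/Crystal3D` (cell `crystal3d-full`), helper
`--supports` the crux `CoaxialWallLaw` (stmt-Ventures-19481, `route-Ventures-StickyWulffConstant`),
REGISTERED line `WallLedgerF` (planner cf-p1 gen 16), stub `stub_coaxialTwoSlabAdhesion`.
Bookkeeping only: the chart data that `forced_vacantSlots_cell` (`…CoaxialWallLawCellEnds`, this
seat) and `forced_runEnds_offset` (`…CoaxialWallLawForcedEnds`) consume, for the three IN-PLANE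
bond classes of the model lattice `Λ₀ = fccStacking 1 √(2/3)` (the basal plane `k = 0` of its
Barlow frame): `u = (0,1,0) = triangularVec₁ 1`, `v = (0,0,1) = triangularVec₂ 1`, `u − v = (0,1,−1)`
(site triples `(k,i,j)`), with `t = (1,0,0)` the out-of-plane generator.  For each class `W` a
frame `(Ea, Eb, W)` of lattice vectors of norm `≤ 1` with `det² = 1/2` that SPANS `Λ₀` over `ℤ`
(the charts `c10`, `c11`, `c22` of `…NoReconstructionGainSampleDeficit`):

* `inPlaneFrame_u` : `(v, v − t, u)`, with `barlowPos k i j = (j+k)•v + (−k)•(v−t) + i•u`;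
* `inPlaneFrame_v` : `(u, v − t, v)`, with `barlowPos k i j = i•u + (−k)•(v−t) + (j+k)•v`;
* `inPlaneFrame_uv` : `(t, u − t, u − v)`, with `barlowPos k i j = (k+i+j)•t + (i+j)•(u−t) + (−j)•(u−v)`;
* `inPlane_generators_eq` : `u = triangularVec₁ 1`, `v = triangularVec₂ 1` (link to
  `coaxial_sine_le_inPlaneClasses` of `…CoaxialWallLawTilt`).

WHAT THIS IS NOT: anything about packings; the stub; rung F-C1 not moved.
-/

noncomputable section

namespace Summit.Ventures.Crystal3D.Theorems

open Summit.Ventures.Crystal3D Matrix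
open Literature.MathematicalPhysics.StatisticalMechanics (barlowPos fccStacking constHagg
  barlowPos_mem triangularVec₁ triangularVec₂)

/-- The in-plane generators of the Barlow frame: `u = (0,1,0) = triangularVec₁ 1` and
`v = (0,0,1) = triangularVec₂ 1`. -/
theorem inPlane_generators_eq :
    barlowPos 1 (Real.sqrt (2 / 3)) constHagg 0 1 0 = triangularVec₁ 1 ∧
      barlowPos 1 (Real.sqrt (2 / 3)) constHagg 0 0 1 = triangularVec₂ 1 := by
  constructor
  · simp [barlowPos]
  · simp [barlowPos]

/-- **Frame for the class `u`**: `(Ea, Eb, W) = (v, v − t, u)`. -/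
theorem inPlaneFrame_u :
    ‖barlowPos 1 (Real.sqrt (2 / 3)) constHagg 0 0 1‖ ≤ 1 ∧
    ‖barlowPos 1 (Real.sqrt (2 / 3)) constHagg (-1) 0 1‖ ≤ 1 ∧
    ‖barlowPos 1 (Real.sqrt (2 / 3)) constHagg 0 1 0‖ = 1 ∧
    (Matrix.det ![WithLp.ofLp (barlowPos 1 (Real.sqrt (2 / 3)) constHagg 0 0 1),
        WithLp.ofLp (barlowPos 1 (Real.sqrt (2 / 3)) constHagg (-1) 0 1),
        WithLp.ofLp (barlowPos 1 (Real.sqrt (2 / 3)) constHagg 0 1 0)]) ^ 2 = 1 / 2 ∧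
    (∀ a b τ : ℤ, (a : ℝ) • barlowPos 1 (Real.sqrt (2 / 3)) constHagg 0 0 1 +
        (b : ℝ) • barlowPos 1 (Real.sqrt (2 / 3)) constHagg (-1) 0 1 +
        (τ : ℝ) • barlowPos 1 (Real.sqrt (2 / 3)) constHagg 0 1 0 ∈ fccStacking 1 (Real.sqrt (2 / 3))) ∧
    (∀ q ∈ fccStacking 1 (Real.sqrt (2 / 3)), ∃ a b τ : ℤ,
        q = (a : ℝ) • barlowPos 1 (Real.sqrt (2 / 3)) constHagg 0 0 1 +
          (b : ℝ) • barlowPos 1 (Real.sqrt (2 / 3)) constHagg (-1) 0 1 +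
          (τ : ℝ) • barlowPos 1 (Real.sqrt (2 / 3)) constHagg 0 1 0) := by
  have hpt : ∀ a b τ : ℤ, barlowPos 1 (Real.sqrt (2 / 3)) constHagg (-b) τ (a + b) =
      (a : ℝ) • barlowPos 1 (Real.sqrt (2 / 3)) constHagg 0 0 1 +
        (b : ℝ) • barlowPos 1 (Real.sqrt (2 / 3)) constHagg (-1) 0 1 +
        (τ : ℝ) • barlowPos 1 (Real.sqrt (2 / 3)) constHagg 0 1 0 := by
    intro a b τ
    rw [barlowPos_fcc_linear 1 _ (-b) τ (a + b), barlowPos_fcc_linear 1 _ (-1) 0 1]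
    push_cast; module
  refine ⟨(norm_barlowPos_fcc_eq_one (by norm_num)).le, (norm_barlowPos_fcc_eq_one (by norm_num)).le,
    norm_barlowPos_fcc_eq_one (by norm_num), det_sq_barlowPos_fcc (by norm_num), ?_, ?_⟩
  · intro a b τ
    rw [← hpt]; exact barlowPos_mem _ _ _
  · rintro q ⟨k, i, j, rfl⟩
    refine ⟨j + k, -k, i, ?_⟩
    have := hpt (j + k) (-k) i
    rw [neg_neg, show j + k + -k = j by ring] at this
    rw [← this]

/-- **Frame for the class `v`**: `(Ea, Eb, W) = (u, v − t, v)`. -/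
theorem inPlaneFrame_v :
    ‖barlowPos 1 (Real.sqrt (2 / 3)) constHagg 0 1 0‖ ≤ 1 ∧
    ‖barlowPos 1 (Real.sqrt (2 / 3)) constHagg (-1) 0 1‖ ≤ 1 ∧
    ‖barlowPos 1 (Real.sqrt (2 / 3)) constHagg 0 0 1‖ = 1 ∧
    (Matrix.det ![WithLp.ofLp (barlowPos 1 (Real.sqrt (2 / 3)) constHagg 0 1 0),
        WithLp.ofLp (barlowPos 1 (Real.sqrt (2 / 3)) constHagg (-1) 0 1),
        WithLp.ofLp (barlowPos 1 (Real.sqrt (2 / 3)) constHagg 0 0 1)]) ^ 2 = 1 / 2 ∧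
    (∀ a b τ : ℤ, (a : ℝ) • barlowPos 1 (Real.sqrt (2 / 3)) constHagg 0 1 0 +
        (b : ℝ) • barlowPos 1 (Real.sqrt (2 / 3)) constHagg (-1) 0 1 +
        (τ : ℝ) • barlowPos 1 (Real.sqrt (2 / 3)) constHagg 0 0 1 ∈ fccStacking 1 (Real.sqrt (2 / 3))) ∧
    (∀ q ∈ fccStacking 1 (Real.sqrt (2 / 3)), ∃ a b τ : ℤ,
        q = (a : ℝ) • barlowPos 1 (Real.sqrt (2 / 3)) constHagg 0 1 0 +
          (b : ℝ) • barlowPos 1 (Real.sqrt (2 / 3)) constHagg (-1) 0 1 +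
          (τ : ℝ) • barlowPos 1 (Real.sqrt (2 / 3)) constHagg 0 0 1) := by
  have hpt : ∀ a b τ : ℤ, barlowPos 1 (Real.sqrt (2 / 3)) constHagg (-b) a (b + τ) =
      (a : ℝ) • barlowPos 1 (Real.sqrt (2 / 3)) constHagg 0 1 0 +
        (b : ℝ) • barlowPos 1 (Real.sqrt (2 / 3)) constHagg (-1) 0 1 +
        (τ : ℝ) • barlowPos 1 (Real.sqrt (2 / 3)) constHagg 0 0 1 := by
    intro a b τ
    rw [barlowPos_fcc_linear 1 _ (-b) a (b + τ), barlowPos_fcc_linear 1 _ (-1) 0 1]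
    push_cast; module
  refine ⟨(norm_barlowPos_fcc_eq_one (by norm_num)).le, (norm_barlowPos_fcc_eq_one (by norm_num)).le,
    norm_barlowPos_fcc_eq_one (by norm_num), det_sq_barlowPos_fcc (by norm_num), ?_, ?_⟩
  · intro a b τ
    rw [← hpt]; exact barlowPos_mem _ _ _
  · rintro q ⟨k, i, j, rfl⟩
    refine ⟨i, -k, j + k, ?_⟩
    have := hpt i (-k) (j + k)
    rw [neg_neg, show -k + (j + k) = j by ring] at this
    rw [← this]

/-- **Frame for the class `u − v`**: `(Ea, Eb, W) = (t, u − t, u − v)`. -/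
theorem inPlaneFrame_uv :
    ‖barlowPos 1 (Real.sqrt (2 / 3)) constHagg 1 0 0‖ ≤ 1 ∧
    ‖barlowPos 1 (Real.sqrt (2 / 3)) constHagg (-1) 1 0‖ ≤ 1 ∧
    ‖barlowPos 1 (Real.sqrt (2 / 3)) constHagg 0 1 (-1)‖ = 1 ∧
    (Matrix.det ![WithLp.ofLp (barlowPos 1 (Real.sqrt (2 / 3)) constHagg 1 0 0),
        WithLp.ofLp (barlowPos 1 (Real.sqrt (2 / 3)) constHagg (-1) 1 0),
        WithLp.ofLp (barlowPos 1 (Real.sqrt (2 / 3)) constHagg 0 1 (-1))]) ^ 2 = 1 / 2 ∧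
    (∀ a b τ : ℤ, (a : ℝ) • barlowPos 1 (Real.sqrt (2 / 3)) constHagg 1 0 0 +
        (b : ℝ) • barlowPos 1 (Real.sqrt (2 / 3)) constHagg (-1) 1 0 +
        (τ : ℝ) • barlowPos 1 (Real.sqrt (2 / 3)) constHagg 0 1 (-1) ∈ fccStacking 1 (Real.sqrt (2 / 3))) ∧
    (∀ q ∈ fccStacking 1 (Real.sqrt (2 / 3)), ∃ a b τ : ℤ,
        q = (a : ℝ) • barlowPos 1 (Real.sqrt (2 / 3)) constHagg 1 0 0 +
          (b : ℝ) • barlowPos 1 (Real.sqrt (2 / 3)) constHagg (-1) 1 0 +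
          (τ : ℝ) • barlowPos 1 (Real.sqrt (2 / 3)) constHagg 0 1 (-1)) := by
  have hpt : ∀ a b τ : ℤ, barlowPos 1 (Real.sqrt (2 / 3)) constHagg (a - b) (b + τ) (-τ) =
      (a : ℝ) • barlowPos 1 (Real.sqrt (2 / 3)) constHagg 1 0 0 +
        (b : ℝ) • barlowPos 1 (Real.sqrt (2 / 3)) constHagg (-1) 1 0 +
        (τ : ℝ) • barlowPos 1 (Real.sqrt (2 / 3)) constHagg 0 1 (-1) := by
    intro a b τ
    rw [barlowPos_fcc_linear 1 _ (a - b) (b + τ) (-τ), barlowPos_fcc_linear 1 _ (-1) 1 0,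
      barlowPos_fcc_linear 1 _ 0 1 (-1)]
    push_cast; module
  refine ⟨(norm_barlowPos_fcc_eq_one (by norm_num)).le, (norm_barlowPos_fcc_eq_one (by norm_num)).le,
    norm_barlowPos_fcc_eq_one (by norm_num), det_sq_barlowPos_fcc (by norm_num), ?_, ?_⟩
  · intro a b τ
    rw [← hpt]; exact barlowPos_mem _ _ _
  · rintro q ⟨k, i, j, rfl⟩
    refine ⟨k + i + j, i + j, -j, ?_⟩
    have := hpt (k + i + j) (i + j) (-j)
    rw [show k + i + j - (i + j) = k by ring, show i + j + -j = i by ring, neg_neg] at this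
    rw [← this]

end Summit.Ventures.Crystal3D.Theorems

end
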